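import Summits.PneNP.PneNP.Theorems.LatticeMagicTargetStubBridgeForms
import Literature.Computability.Complexity.CookLevinSAT
import Literature.Computability.Complexity.PlumbingBricks

/-!
# `stub_bridge`, part 2/6: the game formulas — disjunctions, relabelling, blocks, disjuncts, the generated tautology

Line `SketchIdeator5` of crux `Target` (stmt-PneNP-10709), stub `stub_bridge` (Krajíček,
arXiv:2506.20221 §2). The mathematics of the formulas the proof system `V` proves and the
`DD_V`-instances are made of:

* the tree's `bigDisj` — semantics, tautology from a member, and its expression as a left fold over
  the reversed list (`bigDisj_reverse_cons`, for the code generator); variables of relabelled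
  formulas (`mem_vars_mapVars`), (non-)tautology of negated relabelled CNFs;
* the relation `R_{g,B} = {⟨⟨N, ⟨w, [b]⟩⟩, u⟩ : |u| = |N| ∧ g u = w ∧ B u ≠ b}` read through the total
  pair decoder (`relR`, `mem_relR_iff`) and the instance strings `xin N w b`;
* `block Φ N v w b = ¬ (ofCNF (Φ ⟨N, ⟨w, [b]⟩⟩)).mapVars (tagVar v)`, `disjunct Φ N w⃗ v = ⋀_j block`,
  the list `disjuncts` over the capped enumeration, the guard `2^t ≤ m + 1` and the generated formula
  `genForm Φ (N, w⃗, m)` (the disjoint disjunction, or `⊤` when the pad is short);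
* **`isTautology_genForm`**: under the Cook–Levin specification of `Φ` for `R_{g,B}` and injectivity
  of `g` on each length the generated formula is always a tautology (the disjunct of the vector of
  correct bits has only unsatisfiable blocks); **`pairwise_disjoint_disjuncts`**; and the game
  dictionary: an entirely correct proposal indexes a tautological disjunct and conversely
  (`isTautology_disjunct_of_forall_not_wrong`, `not_wrong_of_isTautology_disjunct`), a transported
  Levin witness falsifies a disjunct (`eval_disjunct_eq_false`).

## References

* J. Krajíček, *A proof complexity conjecture and the Incompleteness theorem*, arXiv:2506.20221, §2
  (`DD_P`, Hypothesis (ST)); J. Krajíček, LMCS 16 (3:9) 2020.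
* S. Arora, B. Barak, *Computational Complexity: A Modern Approach*, CUP 2009, §0.1 (codes), §1.3
  (closure of polynomial time), §2.3 (CNFs, Cook–Levin), Example 2.21.
* S. A. Cook, R. A. Reckhow, JSL 44 (1979), §1 (proof systems).
-/

set_option linter.dupNamespace false -- summit = sub-problem (D-0017)

namespace Summit.PneNP.PneNP.Theorems.LatticeMagicTarget

open Literature.Computability.Complexity
open Literature.Computability.MetaComplexity
open _root_.Computability

namespace StubBridge

/-! ### Disjunctions -/

/-- `bigDisj` of a list with at least two members. -/
theorem bigDisj_cons_of_ne_nil (φ : PropForm ℕ) {l : List (PropForm ℕ)} (hl : l ≠ []) :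
    bigDisj (φ :: l) = PropForm.disj φ (bigDisj l) := by
  cases l with
  | nil => exact absurd rfl hl
  | cons ψ l => rfl

/-- Semantics of the tree's `bigDisj`. -/
theorem eval_bigDisj (σ : ℕ → Bool) : ∀ l : List (PropForm ℕ),
    (bigDisj l).eval σ = l.any fun φ => φ.eval σ
  | [] => rfl
  | [φ] => by
    rw [show bigDisj [φ] = φ from rfl, List.any_cons, List.any_nil, Bool.or_false]
  | φ :: ψ :: l => by
    rw [bigDisj_cons_of_ne_nil φ (List.cons_ne_nil ψ l), PropForm.eval, eval_bigDisj σ (ψ :: l),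
      List.any_cons, List.any_cons, List.any_cons]

/-- A disjunction with a tautological member is a tautology. -/
theorem isTautology_bigDisj_of_mem {l : List (PropForm ℕ)} {φ : PropForm ℕ} (hφ : φ ∈ l)
    (h : φ.IsTautology) : (bigDisj l).IsTautology := fun σ => by
  rw [eval_bigDisj]
  exact List.any_eq_true.2 ⟨φ, hφ, h σ⟩

/-- The left fold `disj φₖ (⋯ (disj φ₁ a))` over `[φ₁, …, φₖ]` from `a`. -/
def disjFold (a : PropForm ℕ) (r : List (PropForm ℕ)) : PropForm ℕ :=
  r.foldl (fun acc φ => PropForm.disj φ acc) a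

/-- **`bigDisj` as a left fold over the reversed list**: `bigDisj (reverse (a :: r)) = disjFold a r`. -/
theorem bigDisj_reverse_cons (a : PropForm ℕ) (r : List (PropForm ℕ)) :
    bigDisj (a :: r).reverse = disjFold a r := by
  induction r using List.reverseRecOn with
  | nil => rfl
  | append_singleton r φ ih =>
    rw [disjFold, List.foldl_append, List.foldl_cons, List.foldl_nil, ← disjFold, ← ih]
    rw [show (a :: (r ++ [φ])).reverse = φ :: (a :: r).reverse by simp]
    exact bigDisj_cons_of_ne_nil φ (by simp)

/-! ### Variables under relabelling -/

/-- Variables of a relabelled formula are images of variables. -/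
theorem mem_vars_mapVars {x : ℕ} (f : ℕ → ℕ) (φ : PropForm ℕ) (h : x ∈ (φ.mapVars f).vars) :
    ∃ y ∈ φ.vars, f y = x := by
  induction φ with
  | var y =>
    refine ⟨y, by simp [PropForm.vars], ?_⟩
    simp only [PropForm.mapVars, PropForm.vars, Finset.mem_singleton] at h
    exact h.symm
  | const b => simp [PropForm.mapVars, PropForm.vars] at h
  | neg φ ih => exact ih h
  | conj φ ψ ih₁ ih₂ =>
    simp only [PropForm.mapVars, PropForm.vars, Finset.mem_union] at h
    rcases h with h | h
    · obtain ⟨y, hy, rfl⟩ := ih₁ h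
      exact ⟨y, by simp [PropForm.vars, hy], rfl⟩
    · obtain ⟨y, hy, rfl⟩ := ih₂ h
      exact ⟨y, by simp [PropForm.vars, hy], rfl⟩
  | disj φ ψ ih₁ ih₂ =>
    simp only [PropForm.mapVars, PropForm.vars, Finset.mem_union] at h
    rcases h with h | h
    · obtain ⟨y, hy, rfl⟩ := ih₁ h
      exact ⟨y, by simp [PropForm.vars, hy], rfl⟩
    · obtain ⟨y, hy, rfl⟩ := ih₂ h
      exact ⟨y, by simp [PropForm.vars, hy], rfl⟩

/-- A relabelled unsatisfiable CNF stays unsatisfiable, so its negation is a tautology (any map). -/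
theorem isTautology_neg_mapVars_ofCNF {Φ : CNF ℕ} (h : ¬ Φ.Satisfiable) (f : ℕ → ℕ) :
    (PropForm.neg ((PropForm.ofCNF Φ).mapVars f)).IsTautology := by
  intro σ
  simp only [PropForm.eval, PropForm.eval_mapVars, PropForm.eval_ofCNF, Bool.not_eq_true']
  by_contra hne
  exact h ⟨σ ∘ f, by simpa using hne⟩

/-- Along an injective relabelling a satisfiable CNF stays satisfiable, so its negation is not a
tautology. -/
theorem not_isTautology_neg_mapVars_ofCNF {Φ : CNF ℕ} (h : Φ.Satisfiable) {f : ℕ → ℕ}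
    (hf : Function.Injective f) : ¬ (PropForm.neg ((PropForm.ofCNF Φ).mapVars f)).IsTautology := by
  obtain ⟨σ, hσ⟩ := h
  intro ht
  have := ht (fun x => σ (Function.invFun f x))
  simp only [PropForm.eval, PropForm.eval_mapVars, PropForm.eval_ofCNF, Bool.not_eq_true'] at this
  have hcomp : ((fun x => σ (Function.invFun f x)) ∘ f) = σ := by
    funext y
    simp [Function.leftInverse_invFun hf y]
  rw [hcomp, hσ] at this
  cases this

/-! ## Part 2: the game formulas — blocks, disjuncts, the generator's value, tautology, disjointness -/

section Instance

open Brick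

variable (Φ : List Bool → CNF ℕ) (g : List Bool → List Bool) (B : List Bool → Bool)

/-- The instance string `⟨N, ⟨w, [b]⟩⟩` of the relation `R_{g,B}` (`N` plays `1ⁿ`). -/
def xin (N w : List Bool) (b : Bool) : List Bool := boolPair N (boolPair w [b])

/-- The relation `R_{g,B}` read through the total pair decoder: `y = ⟨⟨N, ⟨w, c⟩⟩, u⟩` with
`|u| = |N|`, `g u = w` and `c = [¬ B u]`. -/
def relR : Language Bool :=
  {y | (sndF y).length = (fstF (fstF y)).length ∧ g (sndF y) = nthF 1 (fstF y) ∧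
    sndPow 1 (fstF y) = [!B (sndF y)]}

variable {g B} in
/-- Membership of a genuine pair in `R_{g,B}`. -/
theorem mem_relR_iff (N w : List Bool) (b : Bool) (u : List Bool) :
    boolPair (xin N w b) u ∈ relR g B ↔ u.length = N.length ∧ g u = w ∧ B u ≠ b := by
  change ((sndF (boolPair (xin N w b) u)).length = (fstF (fstF (boolPair (xin N w b) u))).length ∧
    g (sndF (boolPair (xin N w b) u)) = nthF 1 (fstF (boolPair (xin N w b) u)) ∧
    sndPow 1 (fstF (boolPair (xin N w b) u)) = [!B (sndF (boolPair (xin N w b) u))]) ↔ _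
  simp only [xin, sndF_boolPair, fstF_boolPair, nthF_succ_boolPair, nthF_zero,
    sndPow_succ_boolPair, sndPow_zero, List.cons.injEq, and_true]
  cases B u <;> cases b <;> simp

/-- Block `(v, w, b)`: the negated Cook–Levin CNF of the instance `⟨N, ⟨w, [b]⟩⟩`, its variables
relabelled into the block tagged by `v`. -/
def block (N v w : List Bool) (b : Bool) : PropForm ℕ :=
  PropForm.neg ((PropForm.ofCNF (Φ (xin N w b))).mapVars (tagVar v))

/-- The disjunct indexed by the bit vector `v`: `⋀_j block (v, w_j, v_j)`. -/
def disjunct (N : List Bool) (ws : List (List Bool)) (v : List Bool) : PropForm ℕ :=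
  conjAcc (block Φ N v) ws v (PropForm.const true)

/-- The parameter of the generator: `(N, w⃗, m)` (`N = 1ⁿ`, the images, the pad length). -/
abbrev Param : Type := List Bool × List (List Bool) × ℕ

/-- The list of disjuncts: one per vector of the capped enumeration. -/
def disjuncts (a : Param) : List (PropForm ℕ) :=
  (vecsFold a.2.2 a.2.1).map (disjunct Φ a.1 a.2.1)

/-- The exponential guard `2^t ≤ m + 1`. -/
def guard (a : Param) : Bool := decide (2 ^ a.2.1.length ≤ a.2.2 + 1)

/-- **The generated formula**: the disjoint disjunction of the disjuncts when the pad is long enough,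
the constant `⊤` otherwise. -/
def genForm (a : Param) : PropForm ℕ :=
  if guard a then bigDisj (disjuncts Φ a) else PropForm.const true

variable {Φ}

/-! #### Blocks -/

/-- An unsatisfiable instance gives a tautological block. -/
theorem isTautology_block {N w : List Bool} {b : Bool} (h : ¬ (Φ (xin N w b)).Satisfiable)
    (v : List Bool) : (block Φ N v w b).IsTautology :=
  isTautology_neg_mapVars_ofCNF h _

/-- A satisfiable instance gives a non-tautological block. -/
theorem not_isTautology_block {N w : List Bool} {b : Bool} (h : (Φ (xin N w b)).Satisfiable)
    (v : List Bool) : ¬ (block Φ N v w b).IsTautology :=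
  not_isTautology_neg_mapVars_ofCNF h (tagVar_injective v)

/-- **Falsifying a block by a transported satisfying assignment.** -/
theorem eval_block_eq_false {t : ℕ} {N v w : List Bool} {b : Bool} (hv : v.length = t) {s : List Bool}
    (hs : (Φ (xin N w b)).eval (fun y => s.getD y false) = true) :
    (block Φ N v w b).eval (fun z => (stretch t (false :: s)).getD z false) = false := by
  simp only [block, PropForm.eval, PropForm.eval_mapVars, PropForm.eval_ofCNF, Bool.not_eq_false']
  have : ((fun z => (stretch t (false :: s)).getD z false) ∘ tagVar v) = fun y => s.getD y false :=
    funext fun y => getD_stretch_tagVar hv s y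
  rw [this, hs]

/-- Variables of a block are tagged by its vector. -/
theorem exists_tagVar_of_mem_vars_block {N v w : List Bool} {b : Bool} {z : ℕ}
    (h : z ∈ (block Φ N v w b).vars) : ∃ y, tagVar v y = z := by
  obtain ⟨y, -, hy⟩ := mem_vars_mapVars (tagVar v) _ h
  exact ⟨y, hy⟩

/-! #### Disjuncts -/

/-- Variables of a disjunct are tagged by its vector. -/
theorem exists_tagVar_of_mem_vars_disjunct {N : List Bool} {ws : List (List Bool)} {v : List Bool} {z : ℕ}
    (h : z ∈ (disjunct Φ N ws v).vars) : ∃ y, tagVar v y = z := by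
  rcases mem_vars_conjAcc (blk := block Φ N v) ws v _ h with h | ⟨w, -, b, hb⟩
  · simp [PropForm.vars] at h
  · exact exists_tagVar_of_mem_vars_block hb

/-- Disjuncts of distinct vectors of the same length share no variable. -/
theorem disjoint_vars_disjunct {N : List Bool} {ws : List (List Bool)} {v v' : List Bool}
    (hlen : v.length = v'.length) (hne : v ≠ v') :
    Disjoint (disjunct Φ N ws v).vars (disjunct Φ N ws v').vars := by
  rw [Finset.disjoint_left]
  intro z hz hz'
  obtain ⟨y, rfl⟩ := exists_tagVar_of_mem_vars_disjunct hz
  obtain ⟨y', hy'⟩ := exists_tagVar_of_mem_vars_disjunct hz'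
  exact hne (tagVar_inj hlen hy'.symm).1

/-- **The disjuncts are pairwise variable-disjoint** (under the guard, where the enumeration is
`allVecs t`, duplicate free). -/
theorem pairwise_disjoint_disjuncts {a : Param} (ha : guard a = true) :
    (disjuncts Φ a).Pairwise fun φ ψ => Disjoint φ.vars ψ.vars := by
  obtain ⟨N, ws, m⟩ := a
  have hg : 2 ^ ws.length ≤ m + 1 := by simpa [guard] using ha
  simp only [disjuncts, vecsFold_eq_allVecs hg]
  rw [List.pairwise_map]
  exact (nodup_allVecs ws.length).imp_of_mem fun {v v'} hv hv' hne =>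
    disjoint_vars_disjunct (by rw [mem_allVecs_iff.1 hv, mem_allVecs_iff.1 hv']) hne

/-- A transported satisfying assignment of one block's instance falsifies the disjunct. -/
theorem eval_disjunct_eq_false {N : List Bool} {ws : List (List Bool)} {v : List Bool} {j : ℕ}
    {w : List Bool} (hw : ws[j]? = some w) {s : List Bool}
    (hs : (Φ (xin N w (v.getD j false))).eval (fun y => s.getD y false) = true) :
    (disjunct Φ N ws v).eval (fun z => (stretch v.length (false :: s)).getD z false) = false :=
  eval_conjAcc_eq_false hw (eval_block_eq_false rfl hs)

section Spec

variable (hΦ : ∀ (N w : List Bool) (b : Bool),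
  (Φ (xin N w b)).Satisfiable ↔ ∃ u : List Bool, u.length = N.length ∧ g u = w ∧ B u ≠ b)

open Classical in
/-- The correct bit of an image `w` at length `n`: `B u` for a preimage `u` of length `n` (any,
they agree under injectivity), `false` if there is none. -/
noncomputable def trueBit (n : ℕ) (w : List Bool) : Bool :=
  if h : ∃ u : List Bool, u.length = n ∧ g u = w then B (Classical.choose h) else false

/-- Specification of `trueBit` under injectivity: it is `B u` for every preimage of length `n`. -/
theorem trueBit_eq (hinj : InjOnLengths g) {n : ℕ} {u : List Bool} (hu : u.length = n) :
    trueBit g B n (g u) = B u := by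
  unfold trueBit
  have h : ∃ u' : List Bool, u'.length = n ∧ g u' = g u := ⟨u, hu, rfl⟩
  rw [dif_pos h]
  have h1 := Classical.choose_spec h
  rw [hinj _ _ (h1.1.trans hu.symm) h1.2]

include hΦ in
/-- The instance at the correct bit is unsatisfiable. -/
theorem not_satisfiable_trueBit (hinj : InjOnLengths g) (N w : List Bool) :
    ¬ (Φ (xin N w (trueBit g B N.length w))).Satisfiable := by
  rw [hΦ]
  rintro ⟨u, hu, rfl, hB⟩
  exact hB (trueBit_eq g B hinj hu).symm

include hΦ in
/-- The disjunct of the vector of correct bits is a tautology. -/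
theorem isTautology_disjunct_trueBits (hinj : InjOnLengths g) (N : List Bool) (ws : List (List Bool)) :
    (disjunct Φ N ws (ws.map (trueBit g B N.length))).IsTautology := by
  refine isTautology_conjAcc (fun _ => rfl) fun j w hw => ?_
  have : (ws.map (trueBit g B N.length)).getD j false = trueBit g B N.length w := by
    rw [List.getD_eq_getElem?_getD, List.getElem?_map, hw]; rfl
  rw [this]
  exact isTautology_block (not_satisfiable_trueBit g B hΦ hinj N w) _

include hΦ in
/-- **The generated formula is always a tautology** (soundness of the new proofs of `V`): under the
guard the enumeration contains the vector of correct bits, whose disjunct is a tautology because `g`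
is injective on length `|N|`; otherwise the formula is `⊤`. -/
theorem isTautology_genForm (hinj : InjOnLengths g) (a : Param) : (genForm Φ a).IsTautology := by
  obtain ⟨N, ws, m⟩ := a
  unfold genForm
  split_ifs with ha
  · have hg : 2 ^ ws.length ≤ m + 1 := by simpa [guard] using ha
    refine isTautology_bigDisj_of_mem ?_ (isTautology_disjunct_trueBits g B hΦ hinj N ws)
    simp only [disjuncts, vecsFold_eq_allVecs hg]
    exact List.mem_map.2 ⟨_, mem_allVecs_iff.2 (by simp), rfl⟩
  · intro σ; rfl

/-! #### Disjuncts against a game instance -/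

variable {t : ℕ}

/-- The images list of an instance. -/
def imgs (I : HBInstance t) : List (List Bool) := List.ofFn fun j => g (I.u j)

/-- Items of the images list. -/
theorem getElem?_imgs (I : HBInstance t) (j : Fin t) : (imgs g I)[(j : ℕ)]? = some (g (I.u j)) := by
  simp [imgs]

/-- Items of the images list, converse. -/
theorem eq_of_getElem?_imgs {I : HBInstance t} {j : ℕ} {w : List Bool} (h : (imgs g I)[j]? = some w) :
    ∃ hj : j < t, w = g (I.u ⟨j, hj⟩) := by
  have hj : j < t := by
    have := List.getElem?_eq_some_iff.1 h
    obtain ⟨hj, -⟩ := this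
    simpa [imgs] using hj
  refine ⟨hj, ?_⟩
  have := getElem?_imgs g I ⟨j, hj⟩
  rw [Fin.val_mk, h] at this
  exact Option.some.inj this

include hΦ in
/-- **An entirely correct proposal indexes a tautological disjunct.** -/
theorem isTautology_disjunct_of_forall_not_wrong (hinj : InjOnLengths g) {N : List Bool}
    {I : HBInstance t} (hI : ∀ j, (I.u j).length = N.length) {v : List Bool}
    (h : ∀ j, ¬ Wrong B I v j) : (disjunct Φ N (imgs g I) v).IsTautology := by
  refine isTautology_conjAcc (fun _ => rfl) fun j w hw => isTautology_block ?_ _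
  obtain ⟨hj, rfl⟩ := eq_of_getElem?_imgs g hw
  rw [hΦ]
  rintro ⟨u, hu, hgu, hB⟩
  have := hinj u (I.u ⟨j, hj⟩) (hu.trans (hI _).symm) hgu
  subst this
  exact h ⟨j, hj⟩ hB

include hΦ in
/-- **A tautological disjunct is indexed by an entirely correct proposal.** -/
theorem not_wrong_of_isTautology_disjunct {N : List Bool} {I : HBInstance t}
    (hI : ∀ j, (I.u j).length = N.length) {v : List Bool}
    (h : (disjunct Φ N (imgs g I) v).IsTautology) (j : Fin t) : ¬ Wrong B I v j := by
  intro hw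
  have ht := isTautology_of_conjAcc h (getElem?_imgs g I j)
  refine not_isTautology_block ?_ v ht
  rw [hΦ]
  exact ⟨I.u j, hI j, rfl, hw⟩

end Spec

end Instance

end StubBridge

/-- **The generated formula is always a tautology** (explicit-binder form, registered sub-goal
`stubBridge_isTautology_genForm` of stmt-PneNP-10709; chain `stub_bridge` 2/6). -/
theorem stubBridge_isTautology_genForm (Φ : List Bool → CNF ℕ) (g : List Bool → List Bool)
    (B : List Bool → Bool)
    (hΦ : ∀ (N w : List Bool) (b : Bool), (Φ (StubBridge.xin N w b)).Satisfiable ↔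
      ∃ u : List Bool, u.length = N.length ∧ g u = w ∧ B u ≠ b)
    (hinj : InjOnLengths g) (a : StubBridge.Param) : (StubBridge.genForm Φ a).IsTautology :=
  StubBridge.isTautology_genForm g B hΦ hinj a

end Summit.PneNP.PneNP.Theorems.LatticeMagicTarget
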